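import Literature.NumberTheory.Rogawski1990.ArchBouazizSpaceH                    -- ★ (D2-P1) p849592: `ArchBzSmoothBounded` = (I₁)+(I₂) «`ContDiffOn ℝ ∞ (Ψ S) (InRegS S)`»
import Literature.NumberTheory.Rogawski1990.ArchBouazizStableFamilyCayleyValue   -- ★ (I₂@cayPt) p850271: `cayPt_mem_inRegS_insert_of_semiregular`, `archRH_mul_stableSum_eq_mul_prod`, `stOrbFamH`
import Literature.NumberTheory.Rogawski1990.ArchBouazizStableFamilyJumpZeroProduct  -- ★ (J-H) p850334 (LH10-p02 (g4)): §2 jump value on product test functions, §3 `hasOneSidedJump_cayPt_of_jump_of_value`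
import HarnessLib

/-!
# (V1-H) — membership in Bouaziz's space makes the Cayley-point value of a family the ONE-RAY limit `x → 0⁺` of the split chart, spectators frozen
# (Bouaziz 1994 §3.1 (I₂) p. 579, §6.2 p. 591; Shelstad 1979 Lemma 4.3 p. 25; Harish-Chandra's `'F_f(1)`)

Topic `NumberTheory/Rogawski1990`; namespace `Literature.NumberTheory.Rogawski1990`.  THEOREMS ONLY (no `def`, no instance, no notation, no axiom, no named fact,
no `sorry`).  Cell `pub/hodgecm-mathlib`, line LH3 (closer stub `stub_N9`, crux H413 = `stmt-HodgeConjecture-24833`), DIRECT ROAD organ J, (J-BRICKS) residual;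
brick **(V1-H)** (LH3-plan (g3) RULINGS #7 (e) 2026-09-02T08:03:50Z, by name); author LH1-p04 (g4).  Lane `--kind proof --supports stmt-HodgeConjecture-24833`
(count-neutral).

THE POINT.  The (J-BRICKS) residual of organ J carries the MEMBERSHIP hypothesis `hBZ : ∀ fH, ArchSmooth₂ L fH → ArchBouazizSpaceH jcH (stOrbFamH L νH fH)`.  Its
smooth clause (I₁)+(I₂) (★ `ArchBzSmoothBounded`: `ContDiffOn ℝ ∞ (Ψ S′) (InRegS S′)` — Bouaziz's `T_{in-reg}`, the REAL walls `x_w = 0` NOT removed) says in particular that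
`Ψ S′`, `S′ = insert w₀ S`, is CONTINUOUS AT the Cayley point `cayPt w₀ s` of a semiregular wall point `s` of the compact place `w₀` (★ `cayPt_mem_inRegS_insert_of_semiregular`,
★ `isOpen_inRegS`).  Hence the value `Ψ S′ (cayPt w₀ s)` that the jump clause (I₃) reads is the limit of `Ψ S′` along ANY path into the Cayley point — in particular along the
ONE-VARIABLE RAY `x ↦ update s w₀ (x, θ₁, θ)` (`θ₁ := s w₀ 1`, `θ := s w₀ 0` and every place `w ≠ w₀` FROZEN), which for `x ≠ 0` runs inside `RegS S′` where the genuine family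
IS the raw product `R_{S′} · Σ chartOrbH` (★ `stOrbFamH_of_mem_regS`).  So the by-statement inputs of ★ (I₂@cayPt) `stOrbFamH_insert_cayPt_eq_mul_prod(_of_continuousAt)` —
the JOINT three-variable (A0-b) limit at `w₀` within `{x ≠ 0}` and the continuity (P-cont) of the spectator functionals — collapse to ONE one-variable right limit at `w₀`;
the spectator factors are CONSTANT along the ray.  (The `G′`-side twin (V1) is F0P3b-p01 (g15)'s, RULINGS #7 (a).)

WHAT IS PROVED.
* §1 (group-free, any finite index type `W`, ANY family `Ψ` with `ArchBzSmoothBounded Ψ`): `ArchBzSmoothBounded.continuousAt` (at every point of `InRegS S`),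
  `….continuousAt_insert_cayPt`; the ray `x ↦ Function.update s w₀ ![x, s w₀ 1, s w₀ 0]`: `continuous_update_ray`, `update_ray_zero` (= `cayPt w₀ s` on the wall
  `s w₀ 0 = s w₀ 2`, ★ `cayPt_eq_update_of_wall`), `tendsto_update_ray_cayPt`, `cayPt_add_smul_single_eq_update_ray` (= the additive `x`-ray `cayPt w₀ s + x • e_{(w₀,0)}` of ★ (V1-G′), ONE ray for both sides),
  `update_ray_mem_regS_insert` (`x ≠ 0` ⟹ in `RegS (insert w₀ S)`),
  `eventually_update_ray_mem_regS_insert`; `….tendsto_insert_cayPt_ray_nhds ∕ _ray` (the value is the ray limit along `𝓝 0` ∕ `𝓝[>] 0`) and the EQUALITY FORM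
  `….insert_cayPt_eq_of_tendsto_ray_of_le` (any `NeBot` filter `l ≤ 𝓝[≠] 0`) ∕ `….insert_cayPt_eq_of_tendsto_ray` (`𝓝[>] 0`): a raw function `F` agreeing with `Ψ S′` on
  `RegS S′` whose ray values tend to `ℓ` ⟹ `Ψ S′ (cayPt w₀ s) = ℓ`.
* §2 (docking, `W = {w : InfinitePlace L ∕∕ IsComplex w}`, the genuine family `stOrbFamH L νH fH`): `stOrbFamH_insert_cayPt_eq_of_tendsto_ray` (membership + ray limit of
  `R_{S′} · Σ chartOrbH` ⟹ value; `…_cayRay` = the same in the additive ray spelling), **`stOrbFamH_insert_cayPt_eq_mul_prod_of_ray`** — the PRODUCT-ROAD closed form with the SAME right-hand side as ★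
  `stOrbFamH_insert_cayPt_eq_mul_prod_of_continuousAt` (so ★ p850334 §3 `hasOneSidedJump_cayPt_of_jump_of_value` is fed VERBATIM), from the product reading `hP1`, the flip
  invariance `hG`, the ray limit of `G` and the ONE-VARIABLE (A0-b) `Tendsto (x ↦ |eˣ − e⁻ˣ| · φ w₀ (x, s w₀ 1, s w₀ 0)) (𝓝[>] 0) (𝓝 ℓ₀)` — NO (P-cont), NO joint limit; and
  `stOrbFamH_insert_cayPt_ne_zero_of_ray` (non-vanishing from `g₀ ≠ 0`, `ℓ₀ ≠ 0` and the spectator VALUES).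
* §3 (the (JH) brick, product Haar convention `νH = (eA⁻¹_* ⊗_w ν_w) ⊗ ν_B` of ★ p850334): **`exists_hasOneSidedJump_stOrbFamH_cayPt_prod_of_ray`** — ★ p850334 §4
  `exists_hasOneSidedJump_stOrbFamH_cayPt_prod` with (P-cont) and `Continuous g` DROPPED and the joint (A0-b) replaced by the one-variable ray limit, under membership:
  `HasOneSidedJump (ν ↦ stOrbFamH L νH fH S (s + ν • nrm w₀)) (cH · stOrbFamH L νH fH (insert w₀ S) (cayPt w₀ s))`.
HONEST LABEL: HC_CM is proved only modulo the 7 printed citations (2 remaining: hLiu418 = `stmt-HodgeConjecture-24832`, h413 = `stmt-HodgeConjecture-24833`) until rung 0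
closes; coordinate∕filter bookkeeping under the membership hypothesis, pays nothing by itself (count-neutral).

## References
* [Bouaziz1994IntegralesOrbitales] A. Bouaziz, *Intégrales orbitales sur les groupes de Lie réductifs*, Ann. Sci. ÉNS 27 (1994) 573–609, §3.1 (I₁)–(I₂) p. 579 («`b_Ψ φ` se
  prolonge en une fonction `C^∞` sur `H_{Ψ-reg}`»), §3.2 (I₃) p. 580, §6.2 p. 591 (`T_{in-reg}`).
* [Shelstad1979] D. Shelstad, *Characters and inner forms of a quasi-split group over ℝ*, Compositio Math. 39 (1979) 11–45, §4 Lemma 4.3 p. 25 (the Cayley transform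
  data `γ₀ = γ₀^s`, the semiregular value), Thm. 4.7 (IIIb) p. 31.
* [Rogawski1990] J. D. Rogawski, *Automorphic Representations of Unitary Groups in Three Variables*, Ann. of Math. Stud. 123 (1990), §8.2 p. 122, §4.1 (4.1.1) p. 39.
-/

set_option autoImplicit false

noncomputable section

open Filter Topology MeasureTheory NumberField NumberField.InfinitePlace Complex Set Function Real
open scoped ContDiff
open Literature.NumberTheory.Automorphic Literature.NumberTheory.Automorphic.UnitaryGroup Literature.NumberTheory.Automorphic.ArchCartan
open Literature.NumberTheory.Automorphic.Shelstad1979.StableOrbitalIntegrals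
open scoped MatrixGroups

namespace Literature.NumberTheory.Rogawski1990

/-! ## §1 Membership ⇒ continuity at the Cayley point ⇒ the value is the one-ray limit (group-free) -/

section Generic

variable {W : Type*} [Fintype W] [DecidableEq W]

omit [DecidableEq W] in
/-- **(I₁)+(I₂) ⇒ CONTINUITY ON `T_{in-reg}`**: a smooth-bounded family is continuous at every point of `InRegS S` (the set is open, ★ `isOpen_inRegS`; `C^∞` on it).
[cite: Bouaziz1994IntegralesOrbitales, §3.1 (I₂) p. 579; §6.2 p. 591] -/
theorem ArchBzSmoothBounded.continuousAt {Ψ : Finset W → (W → Fin 3 → ℝ) → ℂ} (h : ArchBzSmoothBounded Ψ) {S : Finset W} {c : W → Fin 3 → ℝ}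
    (hc : c ∈ InRegS S) : ContinuousAt (Ψ S) c :=
  (h S).1.continuousOn.continuousAt ((isOpen_inRegS S).mem_nhds hc)

/-- **MEMBERSHIP ⇒ CONTINUITY AT THE CAYLEY POINT**: for a smooth-bounded family, a compact-or-not place `w₀` and a point `s` regular at every compact place `w ≠ w₀`
(the semiregularity hypotheses of ★ `ArchBzJump`), `Ψ (insert w₀ S)` is continuous at `cayPt w₀ s` — the Cayley point lies in `InRegS (insert w₀ S)` (★
`cayPt_mem_inRegS_insert_of_semiregular`: the real wall `x_{w₀} = 0` is not removed from `T_{in-reg}`). [cite: Bouaziz1994IntegralesOrbitales, §3.1 (I₂) p. 579]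
[cite: Shelstad1979, Lemma 4.3 (p. 25)] -/
theorem ArchBzSmoothBounded.continuousAt_insert_cayPt {Ψ : Finset W → (W → Fin 3 → ℝ) → ℂ} (h : ArchBzSmoothBounded Ψ) (S : Finset W) (w₀ : W)
    {s : W → Fin 3 → ℝ} (hreg : ∀ w, w ∉ S → w ≠ w₀ → Circle.exp (s w 0) ≠ Circle.exp (s w 2)) :
    ContinuousAt (Ψ (insert w₀ S)) (cayPt w₀ s) :=
  h.continuousAt (cayPt_mem_inRegS_insert_of_semiregular S w₀ hreg)

omit [Fintype W] in
/-- **THE RAY** `x ↦ update s w₀ (x, θ₁, θ)` (local triple at `w₀` with `θ₁ := s w₀ 1`, `θ := s w₀ 0` frozen; every other place frozen at `s w`) is continuous in `x`.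
[cite: Shelstad1979, Lemma 4.3 (p. 25)] -/
theorem continuous_update_ray (s : W → Fin 3 → ℝ) (w₀ : W) : Continuous fun x : ℝ => Function.update s w₀ ![x, s w₀ 1, s w₀ 0] := by
  fun_prop

omit [Fintype W] in
/-- The ray at `x = 0` is the Cayley point, on the wall `θ₀ = θ₂` (★ `cayPt_eq_update_of_wall`). [cite: Shelstad1979, Lemma 4.3 (p. 25)] -/
theorem update_ray_zero {s : W → Fin 3 → ℝ} {w₀ : W} (hs : s w₀ 0 = s w₀ 2) : Function.update s w₀ ![0, s w₀ 1, s w₀ 0] = cayPt w₀ s :=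
  (cayPt_eq_update_of_wall hs).symm

omit [Fintype W] in
/-- The ray at the other places: frozen at `s w`. [cite: Shelstad1979, Lemma 4.3 (p. 25)] -/
theorem update_ray_apply_of_ne (s : W → Fin 3 → ℝ) {w₀ w : W} (hw : w ≠ w₀) (x : ℝ) : Function.update s w₀ ![x, s w₀ 1, s w₀ 0] w = s w :=
  Function.update_of_ne hw _ _

omit [Fintype W] in
/-- The ray at `w₀`: the local triple `(x, s w₀ 1, s w₀ 0)`. [cite: Shelstad1979, Lemma 4.3 (p. 25)] -/
theorem update_ray_apply_self (s : W → Fin 3 → ℝ) (w₀ : W) (x : ℝ) : Function.update s w₀ ![x, s w₀ 1, s w₀ 0] w₀ = ![x, s w₀ 1, s w₀ 0] :=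
  Function.update_self _ _ _

omit [Fintype W] in
/-- **ONE RAY FOR BOTH SIDES**: on the wall `θ₀ = θ₂`, the additive spelling `cayPt w₀ s + x • e_{(w₀,0)}` (the `x`-ray of ★ (V1-G′) `ArchCayleyValueOfMembership`, LH4-p01 (g3), with
`cayPt` for `hcCayPt`) IS `update s w₀ (x, s w₀ 1, s w₀ 0)`. [cite: Shelstad1979, Lemma 4.3 (p. 25)] -/
theorem cayPt_add_smul_single_eq_update_ray {s : W → Fin 3 → ℝ} {w₀ : W} (hs : s w₀ 0 = s w₀ 2) (x : ℝ) :
    cayPt w₀ s + x • (Pi.single w₀ (Pi.single 0 1 : Fin 3 → ℝ) : W → Fin 3 → ℝ) = Function.update s w₀ ![x, s w₀ 1, s w₀ 0] := by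
  funext w l
  by_cases hw : w = w₀
  · subst hw
    rw [update_ray_apply_self, Pi.add_apply, Pi.smul_apply, Pi.single_eq_same, cayPt_eq_update_of_wall hs, Function.update_self]
    fin_cases l <;> simp
  · rw [Pi.add_apply, Pi.smul_apply, Pi.single_eq_of_ne hw, smul_zero, add_zero, cayPt_apply_of_ne hw, update_ray_apply_of_ne s hw]

omit [Fintype W] in
/-- **The ray tends to the Cayley point as `x → 0`** (on the wall `θ₀ = θ₂`). [cite: Shelstad1979, Lemma 4.3 (p. 25)] -/
theorem tendsto_update_ray_cayPt {s : W → Fin 3 → ℝ} {w₀ : W} (hs : s w₀ 0 = s w₀ 2) :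
    Tendsto (fun x : ℝ => Function.update s w₀ ![x, s w₀ 1, s w₀ 0]) (𝓝 0) (𝓝 (cayPt w₀ s)) := by
  rw [← update_ray_zero hs]
  exact (continuous_update_ray s w₀).tendsto 0

omit [Fintype W] in
/-- **For `x ≠ 0` the ray runs inside the REGULAR set of the split chart** `insert w₀ S` (given the semiregularity of `s`: regular at the compact places `w ≠ w₀` and
at the split places of `S`). [cite: Shelstad1979, Lemma 4.3 (p. 25)] [cite: Bouaziz1994IntegralesOrbitales, §3.1 p. 579] -/
theorem update_ray_mem_regS_insert {S : Finset W} {w₀ : W} {s : W → Fin 3 → ℝ} {x : ℝ} (hx : x ≠ 0)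
    (hreg : ∀ w, w ∉ S → w ≠ w₀ → Circle.exp (s w 0) ≠ Circle.exp (s w 2)) (hregS : ∀ w ∈ S, s w 0 ≠ 0) :
    Function.update s w₀ ![x, s w₀ 1, s w₀ 0] ∈ RegS (insert w₀ S) := by
  refine ⟨fun w hw => ?_, fun w hw => ?_⟩
  · rw [Finset.mem_insert, not_or] at hw
    rw [update_ray_apply_of_ne s hw.1]
    exact hreg w hw.2 hw.1
  · by_cases h : w = w₀
    · subst h
      rw [update_ray_apply_self, Matrix.cons_val_zero]
      exact hx
    · rw [update_ray_apply_of_ne s h]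
      rcases Finset.mem_insert.1 hw with h' | h'
      · exact absurd h' h
      · exact hregS w h'

omit [Fintype W] in
/-- Along `𝓝[≠] 0` the ray is eventually (indeed always) in `RegS (insert w₀ S)`. [cite: Shelstad1979, Lemma 4.3 (p. 25)] -/
theorem eventually_update_ray_mem_regS_insert {S : Finset W} {w₀ : W} {s : W → Fin 3 → ℝ}
    (hreg : ∀ w, w ∉ S → w ≠ w₀ → Circle.exp (s w 0) ≠ Circle.exp (s w 2)) (hregS : ∀ w ∈ S, s w 0 ≠ 0) :
    ∀ᶠ x in 𝓝[≠] (0 : ℝ), Function.update s w₀ ![x, s w₀ 1, s w₀ 0] ∈ RegS (insert w₀ S) :=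
  eventually_nhdsWithin_of_forall fun _ hx => update_ray_mem_regS_insert hx hreg hregS

/-- **THE CAYLEY VALUE IS THE RAY LIMIT (two-sided, `𝓝 0`)** for a smooth-bounded family: `Ψ S′ (update s w₀ (x, θ₁, θ)) → Ψ S′ (cayPt w₀ s)` as `x → 0`, `S′ = insert w₀ S`.
[cite: Bouaziz1994IntegralesOrbitales, §3.1 (I₂) p. 579] [cite: Shelstad1979, Lemma 4.3 (p. 25)] -/
theorem ArchBzSmoothBounded.tendsto_insert_cayPt_ray_nhds {Ψ : Finset W → (W → Fin 3 → ℝ) → ℂ} (h : ArchBzSmoothBounded Ψ) {S : Finset W} {w₀ : W}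
    {s : W → Fin 3 → ℝ} (hs : s w₀ 0 = s w₀ 2) (hreg : ∀ w, w ∉ S → w ≠ w₀ → Circle.exp (s w 0) ≠ Circle.exp (s w 2)) :
    Tendsto (fun x : ℝ => Ψ (insert w₀ S) (Function.update s w₀ ![x, s w₀ 1, s w₀ 0])) (𝓝 0) (𝓝 (Ψ (insert w₀ S) (cayPt w₀ s))) :=
  (h.continuousAt_insert_cayPt S w₀ hreg).tendsto.comp (tendsto_update_ray_cayPt hs)

/-- **THE CAYLEY VALUE IS THE ONE-RAY LIMIT `x → 0⁺`** (the form the consumers compute on the regular set). [cite: Bouaziz1994IntegralesOrbitales, §3.1 (I₂) p. 579]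
[cite: Shelstad1979, Lemma 4.3 (p. 25)] -/
theorem ArchBzSmoothBounded.tendsto_insert_cayPt_ray {Ψ : Finset W → (W → Fin 3 → ℝ) → ℂ} (h : ArchBzSmoothBounded Ψ) {S : Finset W} {w₀ : W}
    {s : W → Fin 3 → ℝ} (hs : s w₀ 0 = s w₀ 2) (hreg : ∀ w, w ∉ S → w ≠ w₀ → Circle.exp (s w 0) ≠ Circle.exp (s w 2)) :
    Tendsto (fun x : ℝ => Ψ (insert w₀ S) (Function.update s w₀ ![x, s w₀ 1, s w₀ 0])) (𝓝[>] 0) (𝓝 (Ψ (insert w₀ S) (cayPt w₀ s))) :=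
  (h.tendsto_insert_cayPt_ray_nhds hs hreg).mono_left nhdsWithin_le_nhds

/-- **EQUALITY FORM, any punctured sub-filter**: if `F` agrees with `Ψ S′` on `RegS S′` and `F` along the ray tends to `ℓ` for some non-trivial filter `l ≤ 𝓝[≠] 0`
(`𝓝[>] 0`, `𝓝[<] 0`, `𝓝[≠] 0`, a sequence `xₙ → 0`, `xₙ ≠ 0`, …), then `Ψ S′ (cayPt w₀ s) = ℓ` — uniqueness of limits, the ray being in `RegS S′` for `x ≠ 0`.
[cite: Bouaziz1994IntegralesOrbitales, §3.1 (I₂) p. 579] [cite: Shelstad1979, Lemma 4.3 (p. 25)] -/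
theorem ArchBzSmoothBounded.insert_cayPt_eq_of_tendsto_ray_of_le {Ψ : Finset W → (W → Fin 3 → ℝ) → ℂ} (h : ArchBzSmoothBounded Ψ) {S : Finset W} {w₀ : W}
    {s : W → Fin 3 → ℝ} (hs : s w₀ 0 = s w₀ 2) (hreg : ∀ w, w ∉ S → w ≠ w₀ → Circle.exp (s w 0) ≠ Circle.exp (s w 2)) (hregS : ∀ w ∈ S, s w 0 ≠ 0)
    {F : (W → Fin 3 → ℝ) → ℂ} (hEq : EqOn (Ψ (insert w₀ S)) F (RegS (insert w₀ S))) {l : Filter ℝ} [NeBot l] (hl : l ≤ 𝓝[≠] 0) {ℓ : ℂ}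
    (hF : Tendsto (fun x : ℝ => F (Function.update s w₀ ![x, s w₀ 1, s w₀ 0])) l (𝓝 ℓ)) :
    Ψ (insert w₀ S) (cayPt w₀ s) = ℓ := by
  have h1 : Tendsto (fun x : ℝ => Ψ (insert w₀ S) (Function.update s w₀ ![x, s w₀ 1, s w₀ 0])) l (𝓝 (Ψ (insert w₀ S) (cayPt w₀ s))) :=
    (h.tendsto_insert_cayPt_ray_nhds hs hreg).mono_left (hl.trans nhdsWithin_le_nhds)
  have h2 : (fun x : ℝ => Ψ (insert w₀ S) (Function.update s w₀ ![x, s w₀ 1, s w₀ 0])) =ᶠ[l]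
      fun x : ℝ => F (Function.update s w₀ ![x, s w₀ 1, s w₀ 0]) :=
    ((eventually_update_ray_mem_regS_insert hreg hregS).filter_mono hl).mono fun _ hx => hEq hx
  exact tendsto_nhds_unique (h1.congr' h2) hF

/-- **EQUALITY FORM, `x → 0⁺`**: `F = Ψ S′` on `RegS S′` and `F(ray x) → ℓ` as `x → 0⁺` ⟹ `Ψ S′ (cayPt w₀ s) = ℓ`. [cite: Bouaziz1994IntegralesOrbitales, §3.1 (I₂) p. 579]
[cite: Shelstad1979, Lemma 4.3 (p. 25)] -/
theorem ArchBzSmoothBounded.insert_cayPt_eq_of_tendsto_ray {Ψ : Finset W → (W → Fin 3 → ℝ) → ℂ} (h : ArchBzSmoothBounded Ψ) {S : Finset W} {w₀ : W}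
    {s : W → Fin 3 → ℝ} (hs : s w₀ 0 = s w₀ 2) (hreg : ∀ w, w ∉ S → w ≠ w₀ → Circle.exp (s w 0) ≠ Circle.exp (s w 2)) (hregS : ∀ w ∈ S, s w 0 ≠ 0)
    {F : (W → Fin 3 → ℝ) → ℂ} (hEq : EqOn (Ψ (insert w₀ S)) F (RegS (insert w₀ S))) {ℓ : ℂ}
    (hF : Tendsto (fun x : ℝ => F (Function.update s w₀ ![x, s w₀ 1, s w₀ 0])) (𝓝[>] 0) (𝓝 ℓ)) :
    Ψ (insert w₀ S) (cayPt w₀ s) = ℓ :=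
  h.insert_cayPt_eq_of_tendsto_ray_of_le hs hreg hregS hEq (nhdsGT_le_nhdsNE 0) hF

end Generic

/-! ## §2 Docking: the genuine stable family `stOrbFamH L νH fH` under membership -/

section StOrbFamH

open scoped Classical

variable (L : Type) [Field L] [NumberField L] [IsCMField L]
  [MeasurableSpace (↥(arch (↥(maximalRealSubfield L)) L (IsCMField.complexConj L) 2 (Matrix.of fun i j : Fin 2 => if i.val + j.val + 1 = 2 then (1 : L) else 0)) ×
      ↥(arch (↥(maximalRealSubfield L)) L (IsCMField.complexConj L) 1 (Matrix.of fun i j : Fin 1 => if i.val + j.val + 1 = 1 then (1 : L) else 0)))]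
  [BorelSpace (↥(arch (↥(maximalRealSubfield L)) L (IsCMField.complexConj L) 2 (Matrix.of fun i j : Fin 2 => if i.val + j.val + 1 = 2 then (1 : L) else 0)) ×
      ↥(arch (↥(maximalRealSubfield L)) L (IsCMField.complexConj L) 1 (Matrix.of fun i j : Fin 1 => if i.val + j.val + 1 = 1 then (1 : L) else 0)))]
  (νH : Measure (↥(arch (↥(maximalRealSubfield L)) L (IsCMField.complexConj L) 2 (Matrix.of fun i j : Fin 2 => if i.val + j.val + 1 = 2 then (1 : L) else 0)) ×
      ↥(arch (↥(maximalRealSubfield L)) L (IsCMField.complexConj L) 1 (Matrix.of fun i j : Fin 1 => if i.val + j.val + 1 = 1 then (1 : L) else 0))))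
  [IsFiniteMeasureOnCompacts νH] [νH.IsMulRightInvariant]

/-- **(V1-H) — MEMBERSHIP ⇒ THE CAYLEY VALUE OF `stOrbFamH` IS THE ONE-RAY LIMIT OF THE RAW PRODUCT `R_{S′} · Σ chartOrbH`**: for a compact-or-not `w₀`, a
semiregular wall point `s` (`s w₀ 0 = s w₀ 2`, regular at the compact `w ≠ w₀` and at the split places of `S`), a test function `fH` whose stable family is smooth-bounded
(`hΨ`; consumers holding `hBZ : ArchBouazizSpaceH jcH (stOrbFamH L νH fH)` pass `hBZ.smoothBounded`), if along the ray `x ↦ update s w₀ (x, s w₀ 1, s w₀ 0)`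
`archRH S′ · stableSum S′ (chartOrbH L νH S′ fH) → ℓ` as `x → 0⁺`, then `stOrbFamH L νH fH S′ (cayPt w₀ s) = ℓ` (`S′ = insert w₀ S`; on `RegS S′` the family IS the raw
product, ★ `bzExtend_of_mem_regS`). [cite: Bouaziz1994IntegralesOrbitales, §3.1 (I₂) p. 579; §6.2 p. 591] [cite: Shelstad1979, Lemma 4.3 (p. 25)] -/
theorem stOrbFamH_insert_cayPt_eq_of_tendsto_ray
    (fH : ↥(arch (↥(maximalRealSubfield L)) L (IsCMField.complexConj L) 2 (Matrix.of fun i j : Fin 2 => if i.val + j.val + 1 = 2 then (1 : L) else 0)) ×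
      ↥(arch (↥(maximalRealSubfield L)) L (IsCMField.complexConj L) 1 (Matrix.of fun i j : Fin 1 => if i.val + j.val + 1 = 1 then (1 : L) else 0)) → ℂ)
    (hΨ : ArchBzSmoothBounded (stOrbFamH L νH fH))
    (S : Finset {w : InfinitePlace L // IsComplex w}) (w₀ : {w : InfinitePlace L // IsComplex w}) {s : {w : InfinitePlace L // IsComplex w} → Fin 3 → ℝ}
    (hs : s w₀ 0 = s w₀ 2) (hreg : ∀ w, w ∉ S → w ≠ w₀ → Circle.exp (s w 0) ≠ Circle.exp (s w 2)) (hregS : ∀ w ∈ S, s w 0 ≠ 0) {ℓ : ℂ}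
    (hF : Tendsto (fun x : ℝ => archRH (insert w₀ S) (Function.update s w₀ ![x, s w₀ 1, s w₀ 0]) *
        stableSum (insert w₀ S) (chartOrbH L νH (insert w₀ S) fH) (Function.update s w₀ ![x, s w₀ 1, s w₀ 0])) (𝓝[>] 0) (𝓝 ℓ)) :
    stOrbFamH L νH fH (insert w₀ S) (cayPt w₀ s) = ℓ :=
  hΨ.insert_cayPt_eq_of_tendsto_ray hs hreg hregS (F := fun c => archRH (insert w₀ S) c * stableSum (insert w₀ S) (chartOrbH L νH (insert w₀ S) fH) c)
    (fun c hc => by rw [stOrbFamH_def]; exact bzExtend_of_mem_regS (insert w₀ S) _ hc) hF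

/-- `stOrbFamH_insert_cayPt_eq_of_tendsto_ray` in the ADDITIVE ray spelling `cayPt w₀ s + x • e_{(w₀,0)}` of ★ (V1-G′) (one ray for both sides of the (J-JOIN)).
[cite: Bouaziz1994IntegralesOrbitales, §3.1 (I₂) p. 579] [cite: Shelstad1979, Lemma 4.3 (p. 25)] -/
theorem stOrbFamH_insert_cayPt_eq_of_tendsto_cayRay
    (fH : ↥(arch (↥(maximalRealSubfield L)) L (IsCMField.complexConj L) 2 (Matrix.of fun i j : Fin 2 => if i.val + j.val + 1 = 2 then (1 : L) else 0)) ×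
      ↥(arch (↥(maximalRealSubfield L)) L (IsCMField.complexConj L) 1 (Matrix.of fun i j : Fin 1 => if i.val + j.val + 1 = 1 then (1 : L) else 0)) → ℂ)
    (hΨ : ArchBzSmoothBounded (stOrbFamH L νH fH))
    (S : Finset {w : InfinitePlace L // IsComplex w}) (w₀ : {w : InfinitePlace L // IsComplex w}) {s : {w : InfinitePlace L // IsComplex w} → Fin 3 → ℝ}
    (hs : s w₀ 0 = s w₀ 2) (hreg : ∀ w, w ∉ S → w ≠ w₀ → Circle.exp (s w 0) ≠ Circle.exp (s w 2)) (hregS : ∀ w ∈ S, s w 0 ≠ 0) {ℓ : ℂ}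
    (hF : Tendsto (fun x : ℝ =>
        archRH (insert w₀ S) (cayPt w₀ s + x • (Pi.single w₀ (Pi.single 0 1 : Fin 3 → ℝ) : {w : InfinitePlace L // IsComplex w} → Fin 3 → ℝ)) *
          stableSum (insert w₀ S) (chartOrbH L νH (insert w₀ S) fH)
            (cayPt w₀ s + x • (Pi.single w₀ (Pi.single 0 1 : Fin 3 → ℝ) : {w : InfinitePlace L // IsComplex w} → Fin 3 → ℝ))) (𝓝[>] 0) (𝓝 ℓ)) :
    stOrbFamH L νH fH (insert w₀ S) (cayPt w₀ s) = ℓ := by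
  refine stOrbFamH_insert_cayPt_eq_of_tendsto_ray L νH fH hΨ S w₀ hs hreg hregS ?_
  simpa only [cayPt_add_smul_single_eq_update_ray hs] using hF

/-- **(V1-H), PRODUCT ROAD — THE CLOSED FORM WITH NO (P-cont) AND A ONE-VARIABLE (A0-b)**: at a compact place `w₀ ∉ S` and a semiregular wall point `s`, for a test function
whose stable family is smooth-bounded (`hΨ`, from membership) and whose chart functional on `S′ = insert w₀ S` has the PRODUCT READING `chartOrbH L νH S′ fH c = G c · ∏_w φ w (c w)`
on `RegS S′` (`hP1`, (P1)) with `G` invariant under the compact flips (`hG`) — the binders of ★ (I₂@cayPt) verbatim — given only the ray limit `g₀` of `G` and the ONE-VARIABLE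
limit `|eˣ − e⁻ˣ| · φ w₀ (x, s w₀ 1, s w₀ 0) → ℓ₀` as `x → 0⁺`, the Cayley value is
`g₀ · ∏_w (w = w₀ ? ℓ₀ : w ∈ S ? |e^{s_{w,0}} − e^{−s_{w,0}}| φ w (s w) : (1 − e^{i(s_{w,2} − s_{w,0})}) (φ w (s w) + φ w (s w)^flip))` — the right-hand side of ★
`stOrbFamH_insert_cayPt_eq_mul_prod_of_continuousAt` token for token (the spectator factors are constant along the ray; ★ `archRH_mul_stableSum_eq_mul_prod` reads the raw
product at the regular ray points). [cite: Shelstad1979, Lemma 4.3 (p. 25); §4 p. 22–23] [cite: Bouaziz1994IntegralesOrbitales, §3.1 (I₂) p. 579; §3.2 (I₃) p. 580]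
[cite: Rogawski1990, §8.2 p. 122] -/
theorem stOrbFamH_insert_cayPt_eq_mul_prod_of_ray
    (fH : ↥(arch (↥(maximalRealSubfield L)) L (IsCMField.complexConj L) 2 (Matrix.of fun i j : Fin 2 => if i.val + j.val + 1 = 2 then (1 : L) else 0)) ×
      ↥(arch (↥(maximalRealSubfield L)) L (IsCMField.complexConj L) 1 (Matrix.of fun i j : Fin 1 => if i.val + j.val + 1 = 1 then (1 : L) else 0)) → ℂ)
    (hΨ : ArchBzSmoothBounded (stOrbFamH L νH fH))
    (S : Finset {w : InfinitePlace L // IsComplex w}) {w₀ : {w : InfinitePlace L // IsComplex w}} (hw₀ : w₀ ∉ S)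
    {s : {w : InfinitePlace L // IsComplex w} → Fin 3 → ℝ} (hs : s w₀ 0 = s w₀ 2)
    (hreg : ∀ w, w ∉ S → w ≠ w₀ → Circle.exp (s w 0) ≠ Circle.exp (s w 2)) (hregS : ∀ w ∈ S, s w 0 ≠ 0)
    {G : ({w : InfinitePlace L // IsComplex w} → Fin 3 → ℝ) → ℂ} {φ : {w : InfinitePlace L // IsComplex w} → (Fin 3 → ℝ) → ℂ}
    (hP1 : ∀ c ∈ RegS (insert w₀ S), chartOrbH L νH (insert w₀ S) fH c = G c * ∏ w, φ w (c w))
    (hG : ∀ T : Finset {w : InfinitePlace L // IsComplex w}, (∀ w ∈ T, w ∉ insert w₀ S) → ∀ c, G (flipSet T c) = G c)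
    {g₀ : ℂ} (hGt : Tendsto (fun x : ℝ => G (Function.update s w₀ ![x, s w₀ 1, s w₀ 0])) (𝓝[>] 0) (𝓝 g₀))
    {ℓ₀ : ℂ} (hA0 : Tendsto (fun x : ℝ => (((|Real.exp x - Real.exp (-x)| : ℝ) : ℂ) * φ w₀ ![x, s w₀ 1, s w₀ 0])) (𝓝[>] 0) (𝓝 ℓ₀)) :
    stOrbFamH L νH fH (insert w₀ S) (cayPt w₀ s) =
      g₀ * ∏ w, (if w = w₀ then ℓ₀ else if w ∈ S then (((|Real.exp (s w 0) - Real.exp (-s w 0)| : ℝ) : ℂ) * φ w (s w))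
        else (1 - (Circle.exp (s w 2 - s w 0) : ℂ)) * (φ w (s w) + φ w ![s w 2, s w 1, s w 0])) := by
  refine stOrbFamH_insert_cayPt_eq_of_tendsto_ray L νH fH hΨ S w₀ hs hreg hregS ?_
  -- on the ray (`x > 0`, regular points) the raw functional IS the product of local factors
  have heq : ∀ x : ℝ, 0 < x →
      G (Function.update s w₀ ![x, s w₀ 1, s w₀ 0]) * ∏ w, (if w ∈ insert w₀ S then
          (((|Real.exp (Function.update s w₀ ![x, s w₀ 1, s w₀ 0] w 0) - Real.exp (-Function.update s w₀ ![x, s w₀ 1, s w₀ 0] w 0)| : ℝ) : ℂ) *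
            φ w (Function.update s w₀ ![x, s w₀ 1, s w₀ 0] w))
        else (1 - (Circle.exp (Function.update s w₀ ![x, s w₀ 1, s w₀ 0] w 2 - Function.update s w₀ ![x, s w₀ 1, s w₀ 0] w 0) : ℂ)) *
          (φ w (Function.update s w₀ ![x, s w₀ 1, s w₀ 0] w) +
            φ w ![Function.update s w₀ ![x, s w₀ 1, s w₀ 0] w 2, Function.update s w₀ ![x, s w₀ 1, s w₀ 0] w 1, Function.update s w₀ ![x, s w₀ 1, s w₀ 0] w 0])) =
      archRH (insert w₀ S) (Function.update s w₀ ![x, s w₀ 1, s w₀ 0]) *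
        stableSum (insert w₀ S) (chartOrbH L νH (insert w₀ S) fH) (Function.update s w₀ ![x, s w₀ 1, s w₀ 0]) := fun x hx =>
    (archRH_mul_stableSum_eq_mul_prod (insert w₀ S) hP1 hG (update_ray_mem_regS_insert (ne_of_gt hx) hreg hregS)).symm
  refine Tendsto.congr' (eventually_nhdsWithin_of_forall fun x hx => heq x hx) (hGt.mul (tendsto_finsetProd Finset.univ fun w _ => ?_))
  by_cases hw : w = w₀
  · subst hw
    simp only [if_pos (Finset.mem_insert_self _ S), if_true, update_ray_apply_self, Matrix.cons_val_zero]
    exact hA0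
  · have hmem : (w ∈ insert w₀ S) = (w ∈ S) := by
      rw [Finset.mem_insert, eq_iff_iff, or_iff_right hw]
    simp only [update_ray_apply_of_ne s hw, hmem, if_neg hw]
    exact tendsto_const_nhds

/-- **(V1-H), NON-VANISHING**: under the hypotheses of `stOrbFamH_insert_cayPt_eq_mul_prod_of_ray`, if `g₀ ≠ 0`, `ℓ₀ ≠ 0` and the spectator VALUES do not vanish
(`φ w (s w) ≠ 0` at the split places of `S`; `φ w (s w) + φ w (s w)^flip ≠ 0` at the compact places `w ≠ w₀` — the root factors are non-zero by the semiregularity of `s`,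
★ `abs_exp_sub_exp_neg_ne_zero_iff`, ★ `one_sub_coe_circleExp_sub_ne_zero_iff`), then `stOrbFamH L νH fH (insert w₀ S) (cayPt w₀ s) ≠ 0` — the form in which organ J
DIVIDES the (K0±) jump by the Cayley value ((N3)'s twin without (P-cont)). [cite: Shelstad1979, Lemma 4.3 (p. 25); Thm. 4.7 (IIIb) (p. 31)]
[cite: Bouaziz1994IntegralesOrbitales, §3.2 (I₃) p. 580] -/
theorem stOrbFamH_insert_cayPt_ne_zero_of_ray
    (fH : ↥(arch (↥(maximalRealSubfield L)) L (IsCMField.complexConj L) 2 (Matrix.of fun i j : Fin 2 => if i.val + j.val + 1 = 2 then (1 : L) else 0)) ×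
      ↥(arch (↥(maximalRealSubfield L)) L (IsCMField.complexConj L) 1 (Matrix.of fun i j : Fin 1 => if i.val + j.val + 1 = 1 then (1 : L) else 0)) → ℂ)
    (hΨ : ArchBzSmoothBounded (stOrbFamH L νH fH))
    (S : Finset {w : InfinitePlace L // IsComplex w}) {w₀ : {w : InfinitePlace L // IsComplex w}} (hw₀ : w₀ ∉ S)
    {s : {w : InfinitePlace L // IsComplex w} → Fin 3 → ℝ} (hs : s w₀ 0 = s w₀ 2)
    (hreg : ∀ w, w ∉ S → w ≠ w₀ → Circle.exp (s w 0) ≠ Circle.exp (s w 2)) (hregS : ∀ w ∈ S, s w 0 ≠ 0)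
    {G : ({w : InfinitePlace L // IsComplex w} → Fin 3 → ℝ) → ℂ} {φ : {w : InfinitePlace L // IsComplex w} → (Fin 3 → ℝ) → ℂ}
    (hP1 : ∀ c ∈ RegS (insert w₀ S), chartOrbH L νH (insert w₀ S) fH c = G c * ∏ w, φ w (c w))
    (hG : ∀ T : Finset {w : InfinitePlace L // IsComplex w}, (∀ w ∈ T, w ∉ insert w₀ S) → ∀ c, G (flipSet T c) = G c)
    {g₀ : ℂ} (hGt : Tendsto (fun x : ℝ => G (Function.update s w₀ ![x, s w₀ 1, s w₀ 0])) (𝓝[>] 0) (𝓝 g₀)) (hg₀ : g₀ ≠ 0)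
    {ℓ₀ : ℂ} (hA0 : Tendsto (fun x : ℝ => (((|Real.exp x - Real.exp (-x)| : ℝ) : ℂ) * φ w₀ ![x, s w₀ 1, s w₀ 0])) (𝓝[>] 0) (𝓝 ℓ₀)) (hℓ₀ : ℓ₀ ≠ 0)
    (hsplit : ∀ w ∈ S, φ w (s w) ≠ 0) (hcpt : ∀ w, w ∉ S → w ≠ w₀ → φ w (s w) + φ w ![s w 2, s w 1, s w 0] ≠ 0) :
    stOrbFamH L νH fH (insert w₀ S) (cayPt w₀ s) ≠ 0 := by
  rw [stOrbFamH_insert_cayPt_eq_mul_prod_of_ray L νH fH hΨ S hw₀ hs hreg hregS hP1 hG hGt hA0]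
  refine mul_ne_zero hg₀ (Finset.prod_ne_zero_iff.2 fun w _ => ?_)
  by_cases hw : w = w₀
  · subst hw
    rwa [if_pos rfl]
  · rw [if_neg hw]
    by_cases hwS : w ∈ S
    · rw [if_pos hwS]
      exact mul_ne_zero (Complex.ofReal_ne_zero.2 ((abs_exp_sub_exp_neg_ne_zero_iff _).2 (hregS w hwS))) (hsplit w hwS)
    · rw [if_neg hwS]
      exact mul_ne_zero ((one_sub_coe_circleExp_sub_ne_zero_iff _ _).2 (hreg w hwS hw)) (hcpt w hwS hw)

end StOrbFamH

/-! ## §3 The (JH) brick on the product road under membership: (P-cont) gone, (A0-b) one-variable -/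

section ProductDockingRay

open scoped Classical

variable (L : Type) [Field L] [NumberField L] [IsCMField L]
  [∀ w : {w : InfinitePlace L // IsComplex w}, MeasurableSpace ↥(archLocal L 2 (Matrix.of fun i j : Fin 2 => if i.val + j.val + 1 = 2 then (1 : L) else 0) w)]
  [∀ w : {w : InfinitePlace L // IsComplex w}, BorelSpace ↥(archLocal L 2 (Matrix.of fun i j : Fin 2 => if i.val + j.val + 1 = 2 then (1 : L) else 0) w)]
  [MeasurableSpace ↥(arch (↥(maximalRealSubfield L)) L (IsCMField.complexConj L) 2 (Matrix.of fun i j : Fin 2 => if i.val + j.val + 1 = 2 then (1 : L) else 0))]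
  [BorelSpace ↥(arch (↥(maximalRealSubfield L)) L (IsCMField.complexConj L) 2 (Matrix.of fun i j : Fin 2 => if i.val + j.val + 1 = 2 then (1 : L) else 0))]
  [MeasurableSpace ↥(arch (↥(maximalRealSubfield L)) L (IsCMField.complexConj L) 1 (Matrix.of fun i j : Fin 1 => if i.val + j.val + 1 = 1 then (1 : L) else 0))]
  [BorelSpace ↥(arch (↥(maximalRealSubfield L)) L (IsCMField.complexConj L) 1 (Matrix.of fun i j : Fin 1 => if i.val + j.val + 1 = 1 then (1 : L) else 0))]
  (νw : ∀ w : {w : InfinitePlace L // IsComplex w}, Measure ↥(archLocal L 2 (Matrix.of fun i j : Fin 2 => if i.val + j.val + 1 = 2 then (1 : L) else 0) w))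
  [∀ w, (νw w).IsHaarMeasure] [∀ w, (νw w).IsMulRightInvariant]
  (νB : Measure ↥(arch (↥(maximalRealSubfield L)) L (IsCMField.complexConj L) 1 (Matrix.of fun i j : Fin 1 => if i.val + j.val + 1 = 1 then (1 : L) else 0)))
  [νB.IsHaarMeasure] [νB.IsMulRightInvariant]
  (νH : Measure (↥(arch (↥(maximalRealSubfield L)) L (IsCMField.complexConj L) 2 (Matrix.of fun i j : Fin 2 => if i.val + j.val + 1 = 2 then (1 : L) else 0)) ×
      ↥(arch (↥(maximalRealSubfield L)) L (IsCMField.complexConj L) 1 (Matrix.of fun i j : Fin 1 => if i.val + j.val + 1 = 1 then (1 : L) else 0))))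
  [νH.IsHaarMeasure] [νH.IsMulRightInvariant]
  (hν : νH = ((Measure.pi νw).map (archPiEquivCM 2 L (Matrix.of fun i j : Fin 2 => if i.val + j.val + 1 = 2 then (1 : L) else 0)).symm).prod νB)
  (w₀ : {w : InfinitePlace L // IsComplex w})

include hν in
/-- **THE (JH) BRICK ON THE PRODUCT ROAD, UNDER MEMBERSHIP** — ★ p850334 §4 `exists_hasOneSidedJump_stOrbFamH_cayPt_prod` with its by-statement inputs CUT DOWN by (V1-H):
with the SAME `C₁ > 0` (★ §2's), for every product test function `fH (a, b) = (∏_w f_w((eA a)_w)) · g b` (`f_{w₀} = f₀ ∘ coe`, `f₀ ∈ C_c(M₂(ℂ))`; NO continuity of `g` asked)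
whose stable family is smooth-bounded (`ArchBzSmoothBounded (stOrbFamH L νH fH)` — from the residual's `hBZ fH hfH` by `.smoothBounded`), every label `S ∌ w₀`, every
semiregular wall point `s` of the wall `θ₀ = θ₂` at `w₀`, given BY STATEMENT only
* (A0-b)-RAY: the ONE-VARIABLE right limit `ℓ₀` of `|e^{x} − e^{−x}| · chartOrbHLoc L (insert w₀ S) w₀ ν_{w₀} f_{w₀} (x, s_{w₀,1}, s_{w₀,0})` as `x → 0⁺` (the two spectator
  angles FROZEN — Harish-Chandra's `'F_f(1)` along one ray), and
* (A0-c): the MATCHING `cH · ℓ₀ = 2i · C₁ · cone(f₀, e^{i s_{w₀,0}})` (★ (K0±)'s two-nappe cone integral, verbatim),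
the genuine stable family satisfies the (I₃) order-0 clause with constant `cH`:
**`HasOneSidedJump (ν ↦ stOrbFamH L νH fH S (s + ν • nrm w₀)) (cH · stOrbFamH L νH fH (insert w₀ S) (cayPt w₀ s))`** — NO (P-cont), NO joint limit: the prefactor
`ν_B(B) · g((endoTorus · ·).2)` is CONSTANT along the ray (slot `1` untouched, ★ `endoTorus_snd_eq_of_forall_apply_one`), the spectators of `insert w₀ S` ARE those of `S` off
`w₀` (★ (T-CONGR) `chartOrbHLoc_insert_of_ne`), §2 above gives the value, ★ p850334 §3 the cancellation. [cite: Bouaziz1994IntegralesOrbitales, §3.1 (I₂) p. 579; §3.2 (I₃) p. 580; §6.2 p. 591]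
[cite: Shelstad1979, Lemma 4.3 p. 25; Thm. 4.7 (IIIb) p. 31] [cite: Rogawski1990, §8.2 pp. 119, 122] -/
theorem exists_hasOneSidedJump_stOrbFamH_cayPt_prod_of_ray :
    ∃ C₁ : ℝ, 0 < C₁ ∧
      ∀ (fH : ↥(arch (↥(maximalRealSubfield L)) L (IsCMField.complexConj L) 2 (Matrix.of fun i j : Fin 2 => if i.val + j.val + 1 = 2 then (1 : L) else 0)) ×
          ↥(arch (↥(maximalRealSubfield L)) L (IsCMField.complexConj L) 1 (Matrix.of fun i j : Fin 1 => if i.val + j.val + 1 = 1 then (1 : L) else 0)) → ℂ)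
        (f : ∀ w : {w : InfinitePlace L // IsComplex w}, ↥(archLocal L 2 (Matrix.of fun i j : Fin 2 => if i.val + j.val + 1 = 2 then (1 : L) else 0) w) → ℂ)
        (g : ↥(arch (↥(maximalRealSubfield L)) L (IsCMField.complexConj L) 1 (Matrix.of fun i j : Fin 1 => if i.val + j.val + 1 = 1 then (1 : L) else 0)) → ℂ)
        (_ : ∀ a b, fH (a, b) = (∏ w, f w (archPiEquivCM 2 L (Matrix.of fun i j : Fin 2 => if i.val + j.val + 1 = 2 then (1 : L) else 0) a w)) * g b)
        (_ : ArchBzSmoothBounded (stOrbFamH L νH fH))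
        (f₀ : Matrix (Fin 2) (Fin 2) ℂ → ℂ) (_ : Continuous f₀) (_ : HasCompactSupport f₀)
        (_ : ∀ x : ↥(archLocal L 2 (Matrix.of fun i j : Fin 2 => if i.val + j.val + 1 = 2 then (1 : L) else 0) w₀), f w₀ x = f₀ ((x : GL (Fin 2) ℂ) : Matrix (Fin 2) (Fin 2) ℂ))
        (S : Finset {w : InfinitePlace L // IsComplex w}) (_ : w₀ ∉ S)
        (s : {w : InfinitePlace L // IsComplex w} → Fin 3 → ℝ) (_ : s w₀ 0 = s w₀ 2)
        (_ : ∀ w, w ∉ S → w ≠ w₀ → Circle.exp (s w 0) ≠ Circle.exp (s w 2)) (_ : ∀ w ∈ S, s w 0 ≠ 0)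
        (ℓ₀ : ℂ)
        (_ : Tendsto (fun x : ℝ => (((|Real.exp x - Real.exp (-x)| : ℝ) : ℂ) * chartOrbHLoc L (insert w₀ S) w₀ (νw w₀) (f w₀) ![x, s w₀ 1, s w₀ 0]))
          (𝓝[>] 0) (𝓝 ℓ₀))
        (cH : ℂ)
        (_ : cH * ℓ₀ = 2 * I * ((C₁ : ℂ) * ((∫ p in Ioi (0 : ℝ) ×ˢ Ioc (0 : ℝ) (2 * π),
                f₀ ((!![(1 : ℂ), 1; 1, -1] : Matrix (Fin 2) (Fin 2) ℂ) *
                  (((Circle.exp (s w₀ 0) : Circle) : ℂ) • (1 : Matrix (Fin 2) (Fin 2) ℂ) +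
                    p.1 • Matrix.diagonal ![((Circle.exp (s w₀ 0) : Circle) : ℂ) * I, -(((Circle.exp (s w₀ 0) : Circle) : ℂ) * I)] +
                    p.1 • !![(0 : ℂ), -(((Circle.exp (s w₀ 0) : Circle) : ℂ) * I) * cexp (-((p.2 : ℂ) * I));
                      (((Circle.exp (s w₀ 0) : Circle) : ℂ) * I) * cexp ((p.2 : ℂ) * I), 0]) *
                  !![(1 / 2 : ℂ), 1 / 2; 1 / 2, -(1 / 2)])) +
              ∫ p in Ioi (0 : ℝ) ×ˢ Ioc (0 : ℝ) (2 * π),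
                f₀ ((!![(1 : ℂ), 1; 1, -1] : Matrix (Fin 2) (Fin 2) ℂ) *
                  (((Circle.exp (s w₀ 0) : Circle) : ℂ) • (1 : Matrix (Fin 2) (Fin 2) ℂ) +
                    p.1 • Matrix.diagonal ![-(((Circle.exp (s w₀ 0) : Circle) : ℂ) * I), ((Circle.exp (s w₀ 0) : Circle) : ℂ) * I] +
                    p.1 • !![(0 : ℂ), (((Circle.exp (s w₀ 0) : Circle) : ℂ) * I) * cexp (-((p.2 : ℂ) * I));
                      -(((Circle.exp (s w₀ 0) : Circle) : ℂ) * I) * cexp ((p.2 : ℂ) * I), 0]) *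
                  !![(1 / 2 : ℂ), 1 / 2; 1 / 2, -(1 / 2)])))),
        HasOneSidedJump (fun ν : ℝ => stOrbFamH L νH fH S (s + ν • nrm w₀)) (cH * stOrbFamH L νH fH (insert w₀ S) (cayPt w₀ s)) := by
  obtain ⟨C₁, hC₁, hJ⟩ := exists_hasOneSidedJump_stOrbFamH_add_smul_nrm_prod L νw νB νH hν w₀
  refine ⟨C₁, hC₁, fun fH f g hfH hΨ f₀ hf₀ hf₀c hfw₀ S hw₀ s hs hreg hregS ℓ₀ hA0 cH hcH => ?_⟩
  -- the prefactor is flip-invariant and CONSTANT along the ray (it reads slot `1` only)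
  have hG : ∀ T : Finset {w : InfinitePlace L // IsComplex w}, (∀ w ∈ T, w ∉ insert w₀ S) → ∀ c : {w : InfinitePlace L // IsComplex w} → Fin 3 → ℝ,
      (νB.real Set.univ : ℂ) * g (endoTorus L (insert w₀ S) (flipSet T c)).2 = (νB.real Set.univ : ℂ) * g (endoTorus L (insert w₀ S) c).2 := fun T _ c => by
    rw [endoTorus_snd_eq_of_forall_apply_one L (insert w₀ S) (insert w₀ S) (c := flipSet T c) (c' := c) fun w => by
      rw [flipSet_apply]; split_ifs <;> simp]
  have hGray : ∀ x : ℝ, (νB.real Set.univ : ℂ) * g (endoTorus L (insert w₀ S) (Function.update s w₀ ![x, s w₀ 1, s w₀ 0])).2 =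
      (νB.real Set.univ : ℂ) * g (endoTorus L S s).2 := fun x => by
    rw [endoTorus_snd_eq_of_forall_apply_one L (insert w₀ S) S (c := Function.update s w₀ ![x, s w₀ 1, s w₀ 0]) (c' := s) fun w => by
      by_cases hw : w = w₀
      · subst hw
        rw [update_ray_apply_self]
        simp only [Matrix.cons_val_one, Matrix.cons_val_zero]
      · rw [update_ray_apply_of_ne s hw]]
  have hGt : Tendsto (fun x : ℝ => (νB.real Set.univ : ℂ) * g (endoTorus L (insert w₀ S) (Function.update s w₀ ![x, s w₀ 1, s w₀ 0])).2) (𝓝[>] 0)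
      (𝓝 ((νB.real Set.univ : ℂ) * g (endoTorus L S s).2)) := by
    rw [funext hGray]
    exact tendsto_const_nhds
  -- the value on the product road from the ONE-VARIABLE limit (§2), then ★ p850334 §3's cancellation
  have hV := stOrbFamH_insert_cayPt_eq_mul_prod_of_ray L νH fH hΨ S hw₀ hs hreg hregS
    (G := fun c => (νB.real Set.univ : ℂ) * g (endoTorus L (insert w₀ S) c).2) (φ := fun w v => chartOrbHLoc L (insert w₀ S) w (νw w) (f w) v)
    (fun c _ => chartOrbH_eq_prod_chartOrbHLoc L (insert w₀ S) νw νB νH hν fH f g hfH c) hG hGt hA0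
  exact hasOneSidedJump_cayPt_of_jump_of_value L νH fH S w₀ s (G := fun c => (νB.real Set.univ : ℂ) * g (endoTorus L S c).2)
    (φ := fun w => chartOrbHLoc L S w (νw w) (f w)) (φ' := fun w => chartOrbHLoc L (insert w₀ S) w (νw w) (f w))
    (hJ fH f g hfH f₀ hf₀ hf₀c hfw₀ S hw₀ s hs hreg hregS) hV rfl (fun w hne => funext fun v => chartOrbHLoc_insert_of_ne L w (νw w) hne S (f w) v) hcH

end ProductDockingRay

end Literature.NumberTheory.Rogawski1990

end
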